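import Mathlib
import HarnessLib

/-!
# STUB-IDEAS k2·g8 — `stub_heegnerIndexLowerAtTwo` (crux `SplitBadTwoLowerHalfOfFacts`,
# item stmt-BirchSwinnertonDyer-27851): LITERATURE TRANSFER, typed dictionary — three plans

TECHNIQUE (director): literature transfer (recent-theorem / open-question harvest; typed dictionary).
Node of record: STUB-PLAN v2.2 «HARDEST NOW: T3 = (W-b)′ ∧ the absolute pin of H_W as ONE NET table
`4e − 2c`» and its recommendations **R57** (addressed to «sidea-2 (next gen)» = this seat: the
ENTRY-INDEPENDENCE lemma) and **R58** (the `p = 2` audit of the local ε-isomorphism at `v`, T1-AT R3).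

§A  PLAN A — R57 ENTRY LEDGER.  The T3 constant `C := w + γ + υ` of k2-g6's kernel-checked chain
    (`K2G6.vG0_eq_of_chain`: `vG0 = (w + γ + υ) + (ν − ρ) + s + t − 2τ + 2i + 2ℓ`) is split into ATOMIC
    print digits, each tagged UNIV / TYPE / ENTRY by its printed definition (page-cited in the card):
    the constant `c_sh = ζ_F(2)/(L(1,η)² L(1,ρ_A,Ad))` is SHARED by Liu–Zhang–Zhang Thm 3.8
    [arXiv:1511.08172 p.18] (it enters `w` with sign −1 through the in-range pin of `W₀`) and by
    Yuan–Zhang–Zhang Thm 1.2 [YZZ13 p.13] (it enters `γ` with sign +1) and CANCELS; the numerical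
    prefactors `2^{g−3}δ_E^{1/2}` (LZZ) and `1/4` (YZZ) cancel at `g = 1`, `δ_E = 7`; what is left
    ENTRY-dependent is exactly the period-ratio pin `piP` (LZZ's `P_ι(χ)` against Katz's periods —
    k2-g7's `w_pin`) and the multiplier/height normalisation `mult` (k3-g3's `κ`) — R57's target.
    All proofs `omega`; the mathematics is the TAGGING (card §Mechanism, table L1–L9).
§B  PLAN B — the non-vanishing `F(0) ≠ 0` / `log_{A^±} P^±_{χ′} ≠ 0` at `p = 2` (k2-g7 K3a, k1-g6
    H_C, T1-AT (i)) FROM PRINT: Fuchs–Pham 2015 Thm 2.2 (the `p`-adic Wüstholz theorem: `End(A)`-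
    independent `p`-adic abelian logarithms of algebraic points are `ℚ̄`-independent; ANY `p`, simple
    `A/ℚ̄`) [arXiv:1412.1248 p.4] + the stub's own `¬ IsOfFinAddOrder P`.  The typed step is pure
    linear algebra: an `L`-linear map that is independent on a basis is injective (PROVED below).
§C  PLAN C — R58's audit made mechanical: what the local ε-isomorphism at `v` buys in the anchor
    transport is a LEVEL-MATCHING identity between the analytic and the algebraic `v`-adic digits;
    rank-one ε-isomorphisms are PRINT at `p = 2` on the `(φ,Γ)`/Robba level (Nakamura 2017 §4.2,
    explicit `p = 2` clauses [arXiv:1305.0880 pp.37–39]); the INTEGRAL `Λ(G)`-level with `−1 ∈ G`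
    (Venjakob 2013 needs `G ≅ ℤ_p² × Δ`, `p ∤ #Δ` [arXiv:1204.4269 p.6]) is the located GAP, typed as a
    bounded defect `δ` whose SIGN is all the LOWER bound needs.

No `sorry`; no instance; no notation; no `∃`-frame.  BSD is NOT proved by any of this; neither is the
stub: the file proves the LOGIC (cancellation / injectivity / matching); the research inputs are NAMED in
the card `Ideas/stub_heegnerIndexLowerAtTwo-k2.md` (gate slug `stub-heegnerindexloweratwo-k2-g8`).
-/

set_option linter.dupNamespace false

namespace Summit.BirchSwinnertonDyer.BirchSwinnertonDyer.Cruxes.SplitBadTwoLowerHalfOfFacts.HeegnerIndexTwo.K2G8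

/-! ### §A. PLAN A — the R57 entry ledger (valuation currency of k2-g6 §2, `ℤ`-valued `ord₂` exponents)

Atoms (all `ℤ`; tag in brackets; source in the card's table):
* `csh`  = `ord₂ [ζ_F(2)/(L(1,η)² L(1,ρ_A,Ad))]_alg` — [ENTRY] (through `L(1,ρ_A,Ad)`), SHARED: LZZ Thm 3.8
           numerator/denominator and YZZ Thm 1.2.
* `pref` = `ord₂ (2^{g−3} δ_E^{1/2})` — [UNIV] (`g = [F:ℚ] = 1`, `δ_E = 7`: `pref = −2`), LZZ Thm 3.8 only.
* `four` = `ord₂ (1/4) = −2` — [UNIV], YZZ Thm 1.2 only.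
* `kz`   = `ord₂` of the product of the two Katz–de Shalit interpolation constants of II.4.12 (36)–(37)
           at the limit of the in-range points (periods `Ω, Ω_p`, Gauss digit, Euler digit, `(k−1)!`
           matched against `P_ι`'s growth) — [UNIV+TYPE] (k2-g7's `Da.total + Db.total − vArch`).
* `piP`  = the period-ratio PIN: `ord₂ c` in `P_ι(χ_k)/(Katz period monomial) = c·u^k` — [ENTRY]
           (k2-g7 `w_pin`; R57 residual no. 1 «`P_ι/Ω_p` matching»).
* `locIn`= limit of `ord₂ (ε/L²)_𝔭(χ_k)` along the in-range points — [TYPE] (depends on `n(key)` and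
           the local types at `2` of `ρ_A`, `χ′`).
* `meas` = `ord₂` of the measure conversions (LZZ §1.6 Haar measures vs YZZ Thm 1.2's Tamagawa product
           measure vs YZZ Thm 1.4's probability measure, i.e. the `8 ↔ 2^{g−3}δ_E^{1/2}` conversion, since
           LZZ Prop 4.12's in-range values come from Waldspurger = YZZ Thm 1.4) — [UNIV]; its VALUE is a
           B16 row for the LEAD's table and is NOT asserted here (a UNIV residue shifts the value of `C`,
           never its entry-dependence).
* `arch` = YZZ's archimedean local period `α_∞` and the archimedean normalisation turning
           `L′(1/2,π_A,χ′)` into `L′(W,1)·L(W′,1)` — [UNIV/TYPE].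
* `perW` = matching of `Ω_W Ω_{W′}` with the CM periods implicit in `[·]_alg` — [TYPE] (twisting
           periods by `d` is a function of the local type of `d`, like `υ`).
* `mult` = the parametrisation multiplier / height normalisation (`κ` of k3-g3 (W-e), `[H_c:K]`,
           `deg`) — [ENTRY] (R57 residual no. 2 «multiplier normalisation»).
-/

/-- **Split of E2's exponent** (`w = ord₂ W₀`, `G0·Lin = W₀·𝓛(χ′)`; THM-3.8 ROAD): `W₀` is the limit
of `Ka_k·Kb_k/𝓛(χ_k)` and `𝓛(χ_k) = L(1/2,ρ_A,χ_k)·c_sh·2^{g−3}δ_E^{1/2}·P_ι(χ_k)·(ε/L²)_𝔭(χ_k)`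
(LZZ Thm 3.8), the central `L`-value cancelling against the two Hecke `L`-values inside `Ka_k·Kb_k`
(Artin formalism, k2-g7 `w_pin`): `w = kz − csh − pref − piP − locIn`. -/
def SplitW (w csh pref piP locIn kz : ℤ) : Prop :=
  w = kz - csh - pref - piP - locIn

/-- **Split of E4's exponent** (`γ` = YZZ Thm 1.2's constant in BSD shape):
`γ = csh + four + meas + arch + perW + mult`. -/
def SplitGamma (γ csh four meas arch perW mult : ℤ) : Prop :=
  γ = csh + four + meas + arch + perW + mult

/-- **R57 (i): the T3 constant is `c_sh`-FREE.**  Whatever integer the shared algebraic constant is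
(it differs from one good-pair menu entry to the next through `L(1,ρ_A,Ad)`), it does not occur in
`C = w + γ + υ`. -/
theorem t3Constant_split {w γ υ csh pref piP locIn kz four meas arch perW mult : ℤ}
    (hw : SplitW w csh pref piP locIn kz) (hγ : SplitGamma γ csh four meas arch perW mult) :
    w + γ + υ = (kz - piP - locIn) + (four - pref) + (meas + arch + perW + mult + υ) := by
  unfold SplitW at hw
  unfold SplitGamma at hγ
  omega

/-- **R57 (ii): the two numerical prefactors cancel** at `g = 1`, `δ_E = 7` (`2^{g−3}δ_E^{1/2} = √7/4`
is `1/4` times a `2`-adic unit): `four − pref = 0`.  The two readings are HYPOTHESES (print digits to be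
confirmed in ONE normalisation, B16), not assertions. -/
theorem prefactors_cancel {pref four : ℤ} (hpref : pref = -2) (hfour : four = -2) :
    four - pref = 0 := by
  omega

/-- **R57 (iii): composition with k2-g6's EXACT CHAIN** (`K2G6.vG0_eq_of_chain`, whose conclusion is
the hypothesis `hchain` verbatim): `vG0` in closed form with NO `csh`. -/
theorem vG0_eq_entryLedger {vG0 w γ υ ν ρ s t τ i ℓ csh pref piP locIn kz four meas arch perW mult : ℤ}
    (hchain : vG0 = (w + γ + υ) + (ν - ρ) + s + t - 2 * τ + 2 * i + 2 * ℓ)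
    (hw : SplitW w csh pref piP locIn kz) (hγ : SplitGamma γ csh four meas arch perW mult)
    (hpref : pref = -2) (hfour : four = -2) :
    vG0 = (kz - piP - locIn + meas + arch + perW + mult + υ) + (ν - ρ) + s + t - 2 * τ + 2 * i
      + 2 * ℓ := by
  unfold SplitW at hw
  unfold SplitGamma at hγ
  omega

/-- **R57 (iii⁻): the ONE-SIDED chain** (`K2G6.vG0_lower_of_chain`) composes the same way; for LOWER
only `w ≥ kz − csh − pref − piP − locIn` (E2⁻ pinned from below) and `γ ≥ …` are needed. -/
theorem vG0_lower_entryLedger {vG0 w γ υ ν ρ s t τ i ℓ csh pref piP locIn kz four meas arch perW mult : ℤ}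
    (hchain : (w + γ + υ) + (ν - ρ) + s + t - 2 * τ + 2 * i + 2 * ℓ ≤ vG0)
    (hw : kz - csh - pref - piP - locIn ≤ w) (hγ : csh + four + meas + arch + perW + mult ≤ γ)
    (hpref : pref = -2) (hfour : four = -2) :
    (kz - piP - locIn + meas + arch + perW + mult + υ) + (ν - ρ) + s + t - 2 * τ + 2 * i + 2 * ℓ
      ≤ vG0 := by
  omega

/-- The ledger of ONE good-pair menu entry: its ENTRY atoms (`csh, piP, mult`) and the entry-free
atoms it shares with every other entry serving the same member `W_d`. -/
structure EntryLedger where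
  csh : ℤ
  piP : ℤ
  mult : ℤ
  kz : ℤ
  pref : ℤ
  locIn : ℤ
  four : ℤ
  meas : ℤ
  arch : ℤ
  perW : ℤ
  υ : ℤ

/-- The T3 constant `C = w + γ + υ` of an entry, by `SplitW` / `SplitGamma`. -/
def EntryLedger.C (E : EntryLedger) : ℤ :=
  (E.kz - E.csh - E.pref - E.piP - E.locIn) + (E.csh + E.four + E.meas + E.arch + E.perW + E.mult) + E.υ

/-- Two entries serve the SAME member `W_d` when their entry-free atoms agree (they are functions of
`K₀`, of the local type of `d` and of `W` only — the dictionary of the card, rows L2–L4, L6–L9). -/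
def EntryLedger.SameMember (E E' : EntryLedger) : Prop :=
  E.kz = E'.kz ∧ E.pref = E'.pref ∧ E.locIn = E'.locIn ∧ E.four = E'.four ∧ E.meas = E'.meas ∧
    E.arch = E'.arch ∧ E.perW = E'.perW ∧ E.υ = E'.υ

/-- **R57 (iv): ENTRY-DEPENDENCE IS CARRIED BY `piP` AND `mult` ONLY.**  For two menu entries serving
the same member, the T3 constants differ by `(mult − mult′) − (piP − piP′)`; in particular `csh` (which
DOES differ between entries) never shows.  «C per entry» becomes «C type-free» exactly when the
period-ratio pin and the multiplier normalisation are entry-free — R57's stated target. -/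
theorem entryDependence (E E' : EntryLedger) (h : E.SameMember E') :
    E.C - E'.C = (E.mult - E'.mult) - (E.piP - E'.piP) := by
  obtain ⟨h1, h2, h3, h4, h5, h6, h7, h8⟩ := h
  simp only [EntryLedger.C]
  omega

/-- Corollary: with an entry-free pin and multiplier the constant is entry-free («type-free»). -/
theorem typeFree_of_pin_of_mult (E E' : EntryLedger) (h : E.SameMember E') (hpin : E.piP = E'.piP)
    (hmult : E.mult = E'.mult) : E.C = E'.C := by
  have := entryDependence E E' h
  omega

/-! ### §B. PLAN B — `F(0) ≠ 0` at `p = 2` from the `p`-adic Wüstholz theorem (Fuchs–Pham 2015 Thm 2.2)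

Dictionary: `L = ℚ̄` (or any field containing the values of `χ′` and `K₀`); `N = A(H_c) ⊗_{𝒪_{K₀}} L`
with the `L`-basis `b` induced by an `𝒪_{K₀} ⊗ ℚ`-basis `Q₁,…,Q_r` of `A(H_c) ⊗ ℚ`; `V = ℂ₂` as an
`L`-space; `g` = the `L`-linear extension of `Q ↦ log_{Â,ω}(2^m Q)` (`m` large, so that the points lie in
the convergence disc of `exp`); HYPOTHESIS `LinearIndependent L (g ∘ b)` = Fuchs–Pham Thm 2.2 at `p = 2`
for the simple CM curve `A` (named fact, typer request K-B1); `x = P_{χ′}(f_±) ≠ 0` = YZZ (non-torsion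
of the `χ′`-Heegner vector in analytic rank one; the stub even carries `¬ IsOfFinAddOrder P`).
CONCLUSION `g x ≠ 0` = `log_{A^±} P^±_{χ′}(f_±) ≠ 0` = k2-g7's K3a / `F(0) ≠ 0` / k1-g6's `G0 ≠ 0`. -/

/-- **The typed step of PLAN B**: an `L`-linear map which is linearly independent on a basis is
injective. -/
theorem injective_of_linearIndependent_comp_basis {ι L N V : Type*} [Field L] [AddCommGroup N]
    [Module L N] [AddCommGroup V] [Module L V] (b : Module.Basis ι L N) (g : N →ₗ[L] V)
    (h : LinearIndependent L (g ∘ b)) : Function.Injective g := by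
  have hcomp : (Finsupp.linearCombination L (g ∘ b)) = g ∘ₗ (Finsupp.linearCombination L b) := by
    ext i
    simp [Finsupp.linearCombination_single]
  have hinj : Function.Injective (Finsupp.linearCombination L (g ∘ b)) := h
  intro x y hxy
  have hx := b.linearCombination_repr x
  have hy := b.linearCombination_repr y
  have : Finsupp.linearCombination L (g ∘ b) (b.repr x) =
      Finsupp.linearCombination L (g ∘ b) (b.repr y) := by
    rw [hcomp]
    simp [hx, hy, hxy]
  have hrepr := hinj this
  exact b.repr.injective hrepr

/-- **PLAN B, the non-vanishing**: a nonzero `L`-combination of the basis points has nonzero extended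
logarithm. -/
theorem logExt_ne_zero {ι L N V : Type*} [Field L] [AddCommGroup N] [Module L N] [AddCommGroup V]
    [Module L V] (b : Module.Basis ι L N) (g : N →ₗ[L] V) (h : LinearIndependent L (g ∘ b)) {x : N}
    (hx : x ≠ 0) : g x ≠ 0 := by
  intro hgx
  apply hx
  exact injective_of_linearIndependent_comp_basis b g h (by simpa using hgx)

/-- The finite-sum form used on paper: `F(0) = Σ_i c_i · log(Q_i) ≠ 0` as soon as one `χ′`-coordinate
`c_i` is nonzero (Mathlib `Fintype.linearIndependent_iff`). -/
theorem sum_smul_ne_zero_of_linearIndependent {ι L V : Type*} [Fintype ι] [Field L] [AddCommGroup V]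
    [Module L V] {v : ι → V} (hv : LinearIndependent L v) {c : ι → L} (hc : c ≠ 0) :
    ∑ i, c i • v i ≠ 0 := by
  intro hsum
  apply hc
  funext i
  exact Fintype.linearIndependent_iff.mp hv c hsum i

/-! ### §C. PLAN C — R58's `p = 2` audit of T1-AT R3, typed as LEVEL MATCHING with a bounded defect

Along k1-g7's anchors `ε_N` (`N ≥ N₀`): the analytic `v`-adic digit `an N = A + grow N` ((37)'s
prefactor `n_v(k_N − ½)`-type term + the `Γ`-factor, de Shalit II.4.12/4.14 — print at `p = 2`) and
the algebraic one `al N = B + grow N + δ N` (Bloch–Kato's local factor at `v` of the critical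
character).  The local ε-isomorphism at `v` IS the statement `δ N = 0` (rational level: Nakamura 2017,
any `p`); at the integral level with `−1 ∈ G` only `0 ≤ δ N ≤ Δ` is claimed here (the located gap), and
for the LOWER bound the sign `0 ≤ δ N` suffices. -/

/-- **Exact matching ⇒ the transported constant is level-free** (what R3 buys if the integral
ε-isomorphism holds at `p = 2`). -/
theorem const_indep_of_local_match {an al grow δ : ℕ → ℤ} {A B : ℤ} {N₀ : ℕ}
    (han : ∀ N, an N = A + grow N) (hal : ∀ N, al N = B + grow N + δ N)
    (hmatch : ∀ N, N₀ ≤ N → δ N = 0) : ∀ N, N₀ ≤ N → al N - an N = B - A := by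
  intro N hN
  have h1 := han N
  have h2 := hal N
  have h3 := hmatch N hN
  omega

/-- **One-sided version** (all the LOWER half needs): a NON-NEGATIVE defect can only help,
a defect bounded by `Δ` costs at most `Δ` on the other side. -/
theorem lower_of_nonneg_defect {an al grow δ : ℕ → ℤ} {A B : ℤ}
    (han : ∀ N, an N = A + grow N) (hal : ∀ N, al N = B + grow N + δ N) (hδ : ∀ N, 0 ≤ δ N) :
    ∀ N, B - A ≤ al N - an N := by
  intro N
  have h1 := han N
  have h2 := hal N
  have h3 := hδ N
  omega

theorem upper_of_bounded_defect {an al grow δ : ℕ → ℤ} {A B Δ : ℤ}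
    (han : ∀ N, an N = A + grow N) (hal : ∀ N, al N = B + grow N + δ N) (hδ : ∀ N, δ N ≤ Δ) :
    ∀ N, al N - an N ≤ B - A + Δ := by
  intro N
  have h1 := han N
  have h2 := hal N
  have h3 := hδ N
  omega

end Summit.BirchSwinnertonDyer.BirchSwinnertonDyer.Cruxes.SplitBadTwoLowerHalfOfFacts.HeegnerIndexTwo.K2G8
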